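import Summits.BirchSwinnertonDyer.Rank1Residual.Additive.GordCycLowerBound
import Summits.BirchSwinnertonDyer.Rank1Residual.AdditivePotMult.PotMultDelbourgo2002Bridge
import HarnessLib

/-!
# O7-ord / N10 lower half, Iwasawa currency — CLASS FORMS on the potentially MULTIPLICATIVE locus (M),
# EVERY odd prime incl. `p = 3`, with Delbourgo 2002 Thm. (A)+(B) [(M) case] as the explicit binder
# (cell `b2b-bsdres`, team n1011, seat p01, OWNERS row T-O7; companion of `Additive/GordCycLowerBound.lean`)

HONEST FRAMING (cell `b2b-bsdres`, run/shared/lean/b2b/bsd-rank1-residual/, verbatim in every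
file): prove what is provable now; shrink each hard class to its core with data; no claim beyond
stated classes. Research routes; census output = EVIDENCE / conjecture items, never a Literature
fact; RESIDUAL-MAP marks change only by signed lines. §I O7 stays OPEN, N10 stays CONSTRUCTION;
X3♯(M)/X4(M) stay CONSTRUCTION-SHAPED; nothing is booked; no label changes. COVERAGE (stated first,
referee 1 proviso): this file is the (M)-locus twin of `GordCycLowerBoundClass.lean`; its binder is
team-mate n1011-p16's Literature fact `Delbourgo2002.mainTheorem_potMult` (Delbourgo, J. Number
Theory 95 (2002) Thm. (A)+(B) at an additive prime with `ord_p j < 0`, ANY ODD `p` — so `p = 3`, the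
bulk of O7-ord ∩ (M) and of N10 ∩ (M), IS covered, unlike the (G)-ordinary cell where A175 needs
`p ≥ 5`) through p16's bridge `AdditivePotMult.PotMult.delbourgo2002` (every hypothesis of the fact
discharged in the kernel from `PotMult W p` and `p ≠ 2`: no CM, additivity, `ord_p j < 0`, the twist
witness) and `PotMult.reductionNonAnomalous` (Delbourgo's factor `ℓ = 1` on (M): vacuously
non-anomalous). Theorems only (no definition, no named fact; no `_holds`).

What: for `W` globally minimal, `p` odd, `PotMult W p` (additive, `ord_p j < 0`), `r_an ≤ 1`: IF for
every height datum `Dh` satisfying the clauses of Thm. (B) the regulator is non-degenerate (Delbourgo's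
rider; explicit EVIDENCE binder, rmap-2 g7 certificate; idle in rank `0`) AND the typed input
`CycLowerBoundAt W p Dh` of `GordCycLowerBound.lean` holds, THEN `Typed.MissingLowerBoundAt W p`
(`PotMult.missingLowerBoundAt_rankLeOne_of_cycLowerBound`, class forms `ClassX4M.…`, `ClassX3M.…`);
and the `iff` (`PotMult.cycLowerBoundAt_iff_missingLowerBoundAt`): on (M) the typed input is EXACTLY
the lower half (given the clauses for `Dh`, the rider and GZK). Rank `0` on (M) in Miller currency is
n1011-p07's row (T-N10-low; same input via the rank-0 bridge `cycLowerBoundAt_iff_cycLowerLeadingTermAt_of_rankZero`)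
— not restated here beyond the `r_an ≤ 1` form.

References: [Delbourgo2002] Thm. (A), (B) (p. 40), Hypothesis and `ℓ_p(E) = 1` for `ord_p j < 0`
(p. 39), Example p. 40 (`p = 3`, potentially multiplicative); [Delbourgo1998] §2.5 (p. 151);
[Miller2011LMS] Def. 1.1.
-/

noncomputable section

open scoped Classical NumberField

open WeierstrassCurve NumberField Literature.NumberTheory.EllipticCurves
  Literature.NumberTheory.EllipticCurves.Rank1Residual
  Literature.NumberTheory.EllipticCurves.Rank1Residual.Typed
  Literature.NumberTheory.EllipticCurves.Delbourgo2002
  IsDedekindDomain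

namespace Summit.BirchSwinnertonDyer.Rank1Residual.AdditivePotMult

open Additive

variable {W : WeierstrassCurve ℚ} [W.IsElliptic] [W.IsGloballyMinimal] {p : ℕ} [hp : Fact p.Prime]

/-- **(M), `r_an ≤ 1`, ANY odd `p`: the lower half from the typed input.** For `W` globally minimal,
`p ≠ 2`, `PotMult W p`, `r_an ≤ 1`: granted Delbourgo 2002 Thm. (A)+(B) in the potentially
multiplicative case (`hDelM`, explicit binder; hypotheses discharged by p16's bridge) and
Gross–Zagier–Kolyvagin (`hGZK`), IF every height datum satisfying the clauses of (B) has
non-degenerate regulator AND satisfies `CycLowerBoundAt W p Dh`, THEN `Typed.MissingLowerBoundAt W p`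
(Delbourgo's `ℓ = 1` here: `PotMult.reductionNonAnomalous`). [cite: Delbourgo2002, Theorem (A), (B) (p. 40), Hypothesis (p. 39)]
[cite: Miller2011LMS, Def. 1.1] -/
theorem PotMult.missingLowerBoundAt_rankLeOne_of_cycLowerBound
    (hDelM : Delbourgo2002.mainTheorem_potMult) (hGZK : rank_eq_analyticRank_of_analyticRank_le_one)
    (hpm : PotMult W p) (hp2 : p ≠ 2) (hr : W.analyticRank ≤ 1)
    (hlow : ∀ Dh : PAdicHeightData W p, LeadingTermClauses W p Dh →
      SchneiderConjecture Dh ∧ CycLowerBoundAt W p Dh) :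
    MissingLowerBoundAt W p := by
  obtain ⟨hA, Dh, hB⟩ := hpm.delbourgo2002 hDelM hp2
  obtain ⟨hS, hlowDh⟩ := hlow Dh hB
  exact Additive.missingLowerBoundAt_of_cycLowerBound W p hB hS hA hGZK hr hpm.reductionNonAnomalous
    hlowDh

/-- **(M), `iff` for a given datum**: with the clauses of (B) for `Dh`, the rider, (A)-torsion (from
`hDelM`), GZK, modularity and `r_an ≤ 1`, on the (M) locus `CycLowerBoundAt W p Dh ↔ MissingLowerBoundAt W p`
— the typed input conjectures nothing beyond the `p`-part of BSD there.
[cite: Delbourgo2002, Theorem (A), (B) (p. 40)] [cite: Miller2011LMS, Def. 1.1] -/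
theorem PotMult.cycLowerBoundAt_iff_missingLowerBoundAt
    (hDelM : Delbourgo2002.mainTheorem_potMult) (hGZK : rank_eq_analyticRank_of_analyticRank_le_one)
    (hmod : hasEntireLFunction_rat) (hpm : PotMult W p) (hp2 : p ≠ 2) (hr : W.analyticRank ≤ 1)
    {Dh : PAdicHeightData W p} (hB : LeadingTermClauses W p Dh) (hS : SchneiderConjecture Dh) :
    CycLowerBoundAt W p Dh ↔ MissingLowerBoundAt W p :=
  Additive.cycLowerBoundAt_iff_missingLowerBoundAt W p hB hS (hpm.delbourgo2002 hDelM hp2).1 hGZK hmod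
    hr hpm.reductionNonAnomalous

/-- **X4(M), `r_an ≤ 1`, any odd `p`: the lower half from the typed input** (`ClassX4M = ClassX4 ∧ PotMult`;
`p ≠ 2` is part of `ClassX4`). X4(M) stays CONSTRUCTION-SHAPED / O7 OPEN; nothing booked.
[cite: Delbourgo2002, Theorem (A), (B) (p. 40)] [cite: Miller2011LMS, Def. 1.1] -/
theorem ClassX4M.missingLowerBoundAt_rankLeOne_of_cycLowerBound
    (hDelM : Delbourgo2002.mainTheorem_potMult) (hGZK : rank_eq_analyticRank_of_analyticRank_le_one)
    (hX : ClassX4M W p) (hr : W.analyticRank ≤ 1)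
    (hlow : ∀ Dh : PAdicHeightData W p, LeadingTermClauses W p Dh →
      SchneiderConjecture Dh ∧ CycLowerBoundAt W p Dh) :
    MissingLowerBoundAt W p :=
  hX.potMult.missingLowerBoundAt_rankLeOne_of_cycLowerBound hDelM hGZK hX.p_ne_two hr hlow

/-- **X3♯(M), `r_an ≤ 1`, any odd `p`: the lower half from the typed input** (`ClassX3M = ClassX3 ∧ PotMult ∧ p ≠ 2`;
reducible `E[p]` allowed — the source has no image hypothesis). X3♯(M) stays CONSTRUCTION-SHAPED / O7
OPEN; nothing booked. [cite: Delbourgo2002, Theorem (A), (B) (p. 40)] [cite: Miller2011LMS, Def. 1.1] -/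
theorem ClassX3M.missingLowerBoundAt_rankLeOne_of_cycLowerBound
    (hDelM : Delbourgo2002.mainTheorem_potMult) (hGZK : rank_eq_analyticRank_of_analyticRank_le_one)
    (hX : ClassX3M W p) (hr : W.analyticRank ≤ 1)
    (hlow : ∀ Dh : PAdicHeightData W p, LeadingTermClauses W p Dh →
      SchneiderConjecture Dh ∧ CycLowerBoundAt W p Dh) :
    MissingLowerBoundAt W p :=
  hX.potMult.missingLowerBoundAt_rankLeOne_of_cycLowerBound hDelM hGZK hX.p_ne_two hr hlow

end Summit.BirchSwinnertonDyer.Rank1Residual.AdditivePotMult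

end
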